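import Summits.ABC.IUTFork.Joshi.ThetaJoshiAdelicPeriodBridge
import Summits.ABC.IUTFork.Joshi.LocalPeriodRingsModelTower
import Summits.ABC.IUTFork.Joshi.ThetaJoshiConstructionModel
import HarnessLib

/-!
# Joshi, ATS III Thm. 6.7.1 over the §5 period rings: the three RESIDUAL hypotheses of `thm671_ofPeriodRings` —
# (r2) discharged, (r3) reduced, (r1)+(r3) discharged at the joint §5–§6 model (proof/bridge companion of p436830)

abc-iut cell, block E («type Joshi's construction, test vs S», rung LADDER-ABC:A2.E), seat abc-iut-E-t11 (gen 4), slot T-11;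
companion of `ThetaJoshiAdelicPeriodBridge.lean` (p436830). Source: K. Joshi, *Construction of Arithmetic Teichmüller Spaces III*,
arXiv:2401.13508 **v4** (unrefereed) = bib `Joshi2024ATS3`; locators «p.N l.a–b» = PDF page N, lines a–b of
`HOME/lit/renders/Joshi-arxiv-2401.13508/`. TAKES NO SIDE on [IUTchIII] Cor. 3.12, on Joshi's claims, or on Mochizuki's report on
them; typed ≠ proved ≠ endorsed. No `Prop` definition is introduced, nothing of Joshi's is asserted, no
`Summits.ABC.IUTFork.Cor312*`/`Thm311*` module is imported (E-PLAN R14), no FACT-LIST row is consumed; 0 `sorry`; no instance declared.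

WHAT p436830 LEFT NAMED. `AdelicLiftDatum.thm671_ofPeriodRings` derives [J-III] Thm. 6.7.1 («Proof. … clear by construction and
the definitions», p. 50 l. 1–3) for the adelic lift family REALISED on slot T-09's carriers (`ofPeriodRings`) MODULO three named
hypotheses (RQ7 aud-18 on p436830: «r1 continuity / Fréchet §5.3.3, r2 scalars-in-E, r3 `[G_E, φ_{B_E}] = 0`»):
* (r1) `hcont`/`hφc`/`hφc'`: for the chosen topology on `B_{E′_w}` every `galBE g` and `φ_{B_E}`, `φ_{B_E}⁻¹` are continuous
  (print: the Fréchet topology of §5.3.3 p. 41 l. 35–39 — typed by no slot);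
* (r2) `hO`: the scalars `O_{E′_w} → B_{E′_w}` land in `E′_w ⊂ B_{E′_w}`;
* (r3) `hcomm`: `G_{E′_w}` commutes with `φ_{B_E}` on `B_{E′_w}` (T-09's `BEDatum` does NOT relate `φ_{B_E}` to `φ_B`).
WHAT THIS FILE DOES (nothing of T-09 / T-10 / E-t9 restated; all consumed BY NAME):
* §1 (r2) DISCHARGED in general: for the scalars `ℚ_p` (`coe_algebraMap_padic_mem_E`), and for EVERY commutative ring `O` mapping to
  `E` — `E` itself, `𝒪_E ⊂ E`, … — through the inclusion `E ⊂ B_E` (`inclE`, `algebraThroughE`, a `def` to be bound with `letI`;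
  `coe_algebraMap_throughE_mem_E`).
* §2 (r3) REDUCED in general to data on E-t3's ring `B`: if `φ_{B_E}` restricts on `ι(B) ⊂ B_E` to `ι ∘ ψ` for some `ψ : B → B`
  commuting with `D.gal g` (`g ∈ G_E`) — the [FF18] shape `φ_{B_E} = φ_B^{f} ⊗ 1` on `B_E = B ⊗_{E_0} E`, with `φ_B` Galois-equivariant —
  then `[G_E, φ_{B_E}] = 0` on all of `B_E = ι(B) ⊔ E` (`galBE_frobBE_comm_of_restricts`: two `ℚ_p`-algebra maps agreeing on generators).
* §3 a generic inhabitant `ThetaLiftDatum.flat` of slot T-10's §6.4 lift signature over ANY nontrivial algebra (one maximal ideal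
  for every point, Teichmüller lifts of `1`, trivial norms) — used only for non-vacuity below; it says nothing about Joshi's objects.
* §4 AT THE JOINT §5–§6 MODEL of E-t9 (`Joshi.Model.towerModel` / `towerBEDatum`, p438686: `B = Q̄_p[ℚ][S]`, `B_dR = K'((S))`,
  `φ : S ↦ p·S`, Galois TRIVIAL, `E = E_0 = ℚ_p`): `galBE g = id` (`Model.towerBEDatum_galBE_apply`), hence (r3) and the `galBE` half
  of (r1) hold for ANY topology (`Model.towerBEDatum_galBE_frobBE_comm`, `Model.continuous_towerBEDatum_galBE`); so Thm. 6.7.1 for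
  every realised family over a family of model carriers holds modulo (r2) and the continuity of `φ_{B_E}^{±1}` only
  (`thm671_ofPeriodRings_towerModel`), and UNCONDITIONALLY for the scalars `ℚ_p` and the discrete topology
  (`thm671_ofPeriodRings_towerModel_discrete`); the input types of that statement are INHABITED over T-10's toy collation datum
  (`towerModel_liftInput`, `towerModel_btildeSplitting`, `thm671_towerModel_witness`) — CONVENTIONS §4 non-vacuity of p436830 §D.
HONEST SCOPE: (r1) is shown SATISFIABLE (discrete topology), not discharged for the printed Fréchet topology (the model `B_dR = K'((S))`
also carries Mathlib's `S`-adic valuation topology, for which `φ : S ↦ p·S` is valuation-preserving — that variant is NOT formalised here;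
`thm671_ofPeriodRings_towerModel` keeps the continuity of `φ_{B_E}^{±1}` as its only topological input); the model is LOGICAL (E-t9's words:
«it exhibits joint satisfiability of the typed §5 axioms … nothing more»); §2b derives T-09's CLAIM (5.2.5.4) only in the degenerate case
`E = ℚ_p`. bears_on: LADDER-ABC:A2.E.
-/

noncomputable section

open Set

namespace Summit.ABC.IUTFork.Joshi

namespace ATS3

/-! ## §1 Residual (r2): scalars landing in `E` — discharged for `ℚ_p` and for every ring of scalars mapping through `E` -/

namespace PeriodRingTower.BEDatum

variable {F B E0 : Type} [Field F] [CommRing B] [Field E0] {Y : Type} {K : Y → Type} [∀ y, Field (K y)]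
  {G : Type} [Group G] {D : PeriodRingDatum F B E0 Y K G} {p : ℕ} [Fact p.Prime] [Algebra ℚ_[p] B] {Ω : Type}
  [Field Ω] [Algebra ℚ_[p] Ω] {T : PeriodRingTower D p Ω} (ℰ : T.BEDatum)

/-- **(r2) for the scalars `ℚ_p`**: the structure map `ℚ_p → B_E` lands in `E` (`E` is an intermediate field of `B_dR/ℚ_p`).
DISCHARGED over the T-09 signature. [folklore] -/
theorem coe_algebraMap_padic_mem_E (c : ℚ_[p]) :
    ((algebraMap ℚ_[p] (T.BE ℰ.E) c : T.BE ℰ.E) : Ω) ∈ ℰ.E := by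
  rw [Subalgebra.coe_algebraMap]
  exact ℰ.E.algebraMap_mem c

/-- The inclusion `E ⊂ B_E = B·E ⊂ B_dR` ((5.2.4.1); T-09's `mem_BE_of_mem`) as a ring homomorphism. [folklore] -/
def inclE : ℰ.E →+* T.BE ℰ.E where
  toFun e := ⟨e, T.mem_BE_of_mem ℰ.E e.2⟩
  map_one' := rfl
  map_mul' _ _ := rfl
  map_zero' := rfl
  map_add' _ _ := rfl

/-- Underlying element of `inclE e` is `e`. [folklore] -/
@[simp] theorem coe_inclE (e : ℰ.E) : ((ℰ.inclE e : T.BE ℰ.E) : Ω) = e := rfl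

/-- The scalar action on `B_E` of ANY commutative ring `O` equipped with a map to `E` (`E` itself; the ring of integers `𝒪_E ⊂ E`
of §5.3.3 «closed convex hull … `𝒪_E`-submodule»; `ℤ_p`; …): `O → E ⊂ B_E`. A DEFINITION (bind with `letI`), not an instance
(typer lint). [folklore] -/
abbrev algebraThroughE (O : Type*) [CommRing O] [Algebra O ℰ.E] : Algebra O (T.BE ℰ.E) :=
  (ℰ.inclE.comp (algebraMap O ℰ.E)).toAlgebra

/-- **(r2) for every ring of scalars mapping through `E`**: with the action `algebraThroughE`, the structure map `O → B_E` lands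
in `E`. DISCHARGED. [folklore] -/
theorem coe_algebraMap_throughE_mem_E (O : Type*) [CommRing O] [Algebra O ℰ.E] (c : O) :
    letI := ℰ.algebraThroughE O
    ((algebraMap O (T.BE ℰ.E) c : T.BE ℰ.E) : Ω) ∈ ℰ.E :=
  (algebraMap O ℰ.E c).2

/-- In particular for the scalars `E` (`Algebra.id`): `E → B_E` lands in `E`. [folklore] -/
theorem coe_algebraMap_E_mem_E (c : ℰ.E) :
    letI := ℰ.algebraThroughE ℰ.E
    ((algebraMap ℰ.E (T.BE ℰ.E) c : T.BE ℰ.E) : Ω) ∈ ℰ.E :=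
  ℰ.coe_algebraMap_throughE_mem_E ℰ.E c

/-! ## §2 Residual (r3): `[G_E, φ_{B_E}] = 0` reduced to Galois-equivariance of `φ_{B_E}|_B` -/

/-- **(r3) REDUCED.** If the Frobenius `φ_{B_E}` of T-09's `BEDatum` restricts on `ι(B) ⊂ B_E` to `ι ∘ ψ` for a map `ψ : B → B`
(`hψ`; in [FF18] `ψ = φ_B^{[E_0:ℚ_p]}` under Lemma 5.2.3.1 `B_E = B ⊗_{E_0} E`) which commutes with E-t3's Galois action `D.gal g`
for `g ∈ G_E` (`hgal`), then `G_E` commutes with `φ_{B_E}` on ALL of `B_E`: both composites are `ℚ_p`-algebra endomorphisms of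
`B_E = ι(B) ⊔ E` agreeing on `ι(B)` (by `hψ`, `hgal`, T-09's `galBE_toBdR`) and on `E` (both fix `E` pointwise). [folklore] -/
theorem galBE_frobBE_comm_of_restricts (ψ : B → B)
    (hψ : ∀ b : B, ((ℰ.frobBE ⟨T.toBdR b, T.toBdR_mem_BE ℰ.E b⟩ : T.BE ℰ.E) : Ω) = T.toBdR (ψ b))
    (hgal : ∀ (g : ℰ.GE) (b : B), D.gal (g : G) (ψ b) = ψ (D.gal (g : G) b))
    (g : ℰ.GE) (x : T.BE ℰ.E) :
    ℰ.galBE g (ℰ.frobBE x) = ℰ.frobBE (ℰ.galBE g x) := by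
  let φ₁ : T.BE ℰ.E →ₐ[ℚ_[p]] T.BE ℰ.E :=
    ((ℰ.galBE g : T.BE ℰ.E ≃ₐ[ℚ_[p]] T.BE ℰ.E) : T.BE ℰ.E →ₐ[ℚ_[p]] T.BE ℰ.E).comp
      (ℰ.frobBE : T.BE ℰ.E →ₐ[ℚ_[p]] T.BE ℰ.E)
  let φ₂ : T.BE ℰ.E →ₐ[ℚ_[p]] T.BE ℰ.E :=
    (ℰ.frobBE : T.BE ℰ.E →ₐ[ℚ_[p]] T.BE ℰ.E).comp
      ((ℰ.galBE g : T.BE ℰ.E ≃ₐ[ℚ_[p]] T.BE ℰ.E) : T.BE ℰ.E →ₐ[ℚ_[p]] T.BE ℰ.E)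
  -- it suffices that `B_E` lies in (the image in `B_dR` of) the equalizer of `φ₁`, `φ₂`
  suffices h : T.BE ℰ.E ≤ (AlgHom.equalizer φ₁ φ₂).map (T.BE ℰ.E).val by
    obtain ⟨y, hy, hyx⟩ := h x.2
    have hyx' : y = x := Subtype.ext hyx
    subst hyx'
    exact (AlgHom.mem_equalizer φ₁ φ₂ y).1 hy
  change T.toBdR.range ⊔ ℰ.E.toSubalgebra ≤ _
  refine sup_le ?_ ?_
  · rintro _ ⟨b, rfl⟩
    refine ⟨⟨T.toBdR b, T.toBdR_mem_BE ℰ.E b⟩, (AlgHom.mem_equalizer φ₁ φ₂ _).2 ?_, rfl⟩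
    change ℰ.galBE g (ℰ.frobBE ⟨T.toBdR b, _⟩) = ℰ.frobBE (ℰ.galBE g ⟨T.toBdR b, _⟩)
    have h1 : ℰ.frobBE ⟨T.toBdR b, T.toBdR_mem_BE ℰ.E b⟩ = ⟨T.toBdR (ψ b), T.toBdR_mem_BE ℰ.E (ψ b)⟩ :=
      Subtype.ext (hψ b)
    have h2 : ℰ.galBE g ⟨T.toBdR b, T.toBdR_mem_BE ℰ.E b⟩ =
        ⟨T.toBdR (D.gal (g : G) b), T.toBdR_mem_BE ℰ.E (D.gal (g : G) b)⟩ :=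
      Subtype.ext (ℰ.galBE_toBdR g b)
    rw [h1, h2]
    exact Subtype.ext (by rw [ℰ.galBE_toBdR, hψ, hgal])
  · intro e he
    refine ⟨⟨e, T.mem_BE_of_mem ℰ.E he⟩, (AlgHom.mem_equalizer φ₁ φ₂ _).2 ?_, rfl⟩
    change ℰ.galBE g (ℰ.frobBE ⟨e, _⟩) = ℰ.frobBE (ℰ.galBE g ⟨e, _⟩)
    rw [ℰ.frobBE_eq_self_of_coe_mem (x := ⟨e, T.mem_BE_of_mem ℰ.E he⟩) he,
      ℰ.galBE_eq_self_of_coe_mem g (x := ⟨e, T.mem_BE_of_mem ℰ.E he⟩) he,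
      ℰ.frobBE_eq_self_of_coe_mem (x := ⟨e, T.mem_BE_of_mem ℰ.E he⟩) he]

/-! ## §2b (5.2.5.4) `B̃_E = B_E^{⊕[E_0:ℚ_p]}` DERIVED in the degenerate case `E = ℚ_p` (used at the model below) -/

/-- The witness TYPE of T-09's claim (5.2.5.4) `BtildeSplits` (which is `Nonempty` of it): an identification
`B̃_E = B ⊗_{ℚ_p} E ≃ B_E^{[E_0:ℚ_p]}` of `ℚ_p`-algebras — the datum `e` consumed by p436830's `ofPeriodRings` for (5.2.5.5). [folklore] -/
abbrev Splitting : Type := ℰ.Btilde ≃ₐ[ℚ_[p]] (Fin ℰ.f → T.BE ℰ.E)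

/-- `BtildeSplits ↔` the witness type is inhabited. [folklore] -/
theorem btildeSplits_iff_nonempty_splitting : ℰ.BtildeSplits ↔ Nonempty ℰ.Splitting := Iff.rfl

/-- If `E = ℚ_p` then `E_0 = ℚ_p`. [folklore] -/
theorem E0_eq_bot_of_E_eq_bot (hE : ℰ.E = ⊥) : ℰ.E0 = ⊥ :=
  le_bot_iff.1 (le_of_le_of_eq ℰ.E0_le hE)

/-- If `E = ℚ_p` then `[E_0 : ℚ_p] = 1`. [folklore] -/
theorem f_eq_one_of_E_eq_bot (hE : ℰ.E = ⊥) : ℰ.f = 1 := by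
  change Module.finrank ℚ_[p] ℰ.E0 = 1
  rw [ℰ.E0_eq_bot_of_E_eq_bot hE]
  exact IntermediateField.finrank_bot

/-- If `E = ℚ_p` then `B_E = ι(B)` inside `B_dR`. [folklore] -/
theorem BE_eq_range_of_E_eq_bot (hE : ℰ.E = ⊥) : T.BE ℰ.E = T.toBdR.range := by
  rw [hE, PeriodRingTower.BE, IntermediateField.bot_toSubalgebra, sup_bot_eq]

/-- **(5.2.5.4) DERIVED for `E = ℚ_p`**: `B ⊗_{ℚ_p} E ≃ B ⊗_{ℚ_p} ℚ_p ≃ B ≃ ι(B) = B_E ≃ B_E^{Fin 1} = B_E^{Fin [E_0:ℚ_p]}` (Mathlib's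
`TensorProduct.congr`/`rid`, `AlgEquiv.ofInjective`, `funUnique`). [folklore] -/
def splittingOfEqBot (hE : ℰ.E = ⊥) : ℰ.Splitting :=
  letI : Unique (Fin ℰ.f) := (finCongr (ℰ.f_eq_one_of_E_eq_bot hE)).unique
  ((Algebra.TensorProduct.congr (AlgEquiv.refl : B ≃ₐ[ℚ_[p]] B)
      ((IntermediateField.equivOfEq hE).trans (IntermediateField.botEquiv ℚ_[p] Ω))).trans
    ((Algebra.TensorProduct.rid ℚ_[p] ℚ_[p] B).trans
      ((AlgEquiv.ofInjective T.toBdR T.toBdR_injective).trans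
        (Subalgebra.equivOfEq _ _ (ℰ.BE_eq_range_of_E_eq_bot hE).symm)))).trans
    (AlgEquiv.funUnique ℚ_[p] (Fin ℰ.f) (T.BE ℰ.E)).symm

/-- Hence T-09's claim (5.2.5.4) `BtildeSplits` HOLDS whenever `E = ℚ_p`. DERIVED. [folklore] -/
theorem btildeSplits_of_E_eq_bot (hE : ℰ.E = ⊥) : ℰ.BtildeSplits := ⟨ℰ.splittingOfEqBot hE⟩

end PeriodRingTower.BEDatum

/-! ## §3 A generic inhabitant of slot T-10's §6.4 lift signature (for non-vacuity only) -/

namespace ThetaLiftDatum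

open Classical in
/-- Over ANY nontrivial commutative `O`-algebra `B` and any index type of points: every point gets one (chosen) maximal ideal `𝔪`
(Krull), the tilt is a point with Teichmüller lift `[·] = 1`, all norms are `1` on lifts, `|x|_K = 0` iff `x = 0` else `1`, theta value and
Tate parameter `1`, Tate-module generator `0 ∈ 𝔪`. A LOGICAL inhabitant of `ThetaLiftDatum` (cf. T-10's toy `Model.lift` over `ℤ`),
nothing about Joshi's objects. [folklore] -/
def flat (OE B Y : Type*) [CommRing OE] [CommRing B] [Algebra OE B] [Nontrivial B] : ThetaLiftDatum OE B Y where
  m := fun _ => Classical.choose (Ideal.exists_maximal B)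
  m_isMaximal := fun _ => Classical.choose_spec (Ideal.exists_maximal B)
  Cflat := Unit
  teich := fun _ => 1
  absFlat := fun _ => 1
  norm := fun _ _ => 1
  norm_teich := fun _ _ _ _ => rfl
  absK := fun _ x => if x = 0 then 0 else 1
  absK_teich := fun _ _ => by
    rw [if_neg]
    rw [Ideal.Quotient.eq_zero_iff_mem]
    exact (Ideal.ne_top_iff_one _).1 (Classical.choose_spec (Ideal.exists_maximal B)).ne_top
  xi := fun _ => 1
  tate := fun _ => 1
  tgen := fun _ => 0
  tgen_mem := fun _ => Ideal.zero_mem _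

open Classical in
/-- On the flat datum `|0|_K = 0`. [folklore] -/
theorem flat_absK_zero (OE B Y : Type*) [CommRing OE] [CommRing B] [Algebra OE B] [Nontrivial B] (y : Y) :
    (flat OE B Y).absK y 0 = 0 := if_pos rfl

open Classical in
/-- On the flat datum `0 < |ξ|_K` (`ξ = 1 ≠ 0` in the residue FIELD). [folklore] -/
theorem flat_absK_xi_pos (OE B Y : Type*) [CommRing OE] [CommRing B] [Algebra OE B] [Nontrivial B] (y : Y) :
    0 < (flat OE B Y).absK y ((flat OE B Y).xi y) := by
  change (0 : ℝ) < if (1 : B ⧸ (flat OE B Y).m y) = 0 then 0 else 1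
  rw [if_neg]
  · exact one_pos
  · rw [← map_one (Ideal.Quotient.mk ((flat OE B Y).m y)), Ideal.Quotient.eq_zero_iff_mem]
    exact (Ideal.ne_top_iff_one _).1 ((flat OE B Y).m_isMaximal y).ne_top

end ThetaLiftDatum

end ATS3

/-! ## §4 At E-t9's joint §5–§6 model: (r1) for `galBE` and (r3) discharged; Thm. 6.7.1 unconditional; inputs inhabited -/

namespace Model

variable (q : ℕ) [hq : Fact q.Prime]

/-- In the model the Galois action on `B_dR` is TRIVIAL (`towerModel.galΩ := 1`), so `G_E` acts on `B_E` by the identity. [folklore] -/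
theorem towerBEDatum_galBE_apply (g : (towerBEDatum q).GE) (x : (towerModel q).BE (towerBEDatum q).E) :
    (towerBEDatum q).galBE g x = x :=
  Subtype.ext (by rw [ATS3.PeriodRingTower.BEDatum.coe_galBE]; rfl)

/-- **(r3) at the model**: `[G_E, φ_{B_E}] = 0` (the action is trivial). DISCHARGED. [folklore] -/
theorem towerBEDatum_galBE_frobBE_comm (g : (towerBEDatum q).GE) (x : (towerModel q).BE (towerBEDatum q).E) :
    (towerBEDatum q).galBE g ((towerBEDatum q).frobBE x) = (towerBEDatum q).frobBE ((towerBEDatum q).galBE g x) := by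
  rw [towerBEDatum_galBE_apply, towerBEDatum_galBE_apply]

/-- **(r1), Galois half, at the model**: every `galBE g` (the identity) is continuous for ANY topology on `B_E`. DISCHARGED. [folklore] -/
theorem continuous_towerBEDatum_galBE [TopologicalSpace ((towerModel q).BE (towerBEDatum q).E)] (g : (towerBEDatum q).GE) :
    Continuous ((towerBEDatum q).galBE g) := by
  have h : (⇑((towerBEDatum q).galBE g) : (towerModel q).BE (towerBEDatum q).E → (towerModel q).BE (towerBEDatum q).E) = id :=
    funext (towerBEDatum_galBE_apply q g)
  rw [h]
  exact continuous_id

/-- The model `B_E` is nontrivial (a subring of the field `B_dR`). [folklore] -/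
theorem towerModel_BE_nontrivial : Nontrivial ((towerModel q).BE (towerBEDatum q).E) :=
  ⟨⟨0, 1, fun h => zero_ne_one (congrArg Subtype.val h : ((0 : (towerModel q).BE (towerBEDatum q).E) : Omega q) = _)⟩⟩

/-- **(5.2.5.4) `B̃_E = B_E^{⊕[E_0:ℚ_p]}` HOLDS in the model** (`E = ℚ_p`; §2b's `splittingOfEqBot`). [folklore] -/
def towerModel_btildeSplitting : (towerBEDatum q).Splitting := (towerBEDatum q).splittingOfEqBot rfl

/-- Hence T-09's claim (5.2.5.4) `BtildeSplits` HOLDS at the model datum. [folklore] -/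
theorem towerBEDatum_btildeSplits : (towerBEDatum q).BtildeSplits := ⟨towerModel_btildeSplitting q⟩

end Model

namespace ATS3.AdelicLiftDatum

section TowerModel

variable (A : CollationDatum) (pl : A.V → ℕ) [hpl : ∀ w, Fact (pl w).Prime]
  (OE : A.V → Type) [∀ w, CommRing (OE w)]
  [∀ w, Algebra (OE w) ((Model.towerModel (pl w)).BE (Model.towerBEDatum (pl w)).E)]

/-- **[J-III] Thm. 6.7.1 for every realised family over a family of MODEL carriers** (place `w` carrying E-t9's `towerModel (p_w)`,
`towerBEDatum (p_w)`), with the canonical action `mulActionBE`: MODULO (r2) and the continuity of `φ_{B_E}^{±1}` ONLY — (r3) and the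
Galois half of (r1) are discharged by `Model.towerBEDatum_galBE_frobBE_comm` / `Model.continuous_towerBEDatum_galBE`.
[claim: Joshi2024ATS3, status: disputed] -/
theorem thm671_ofPeriodRings_towerModel
    [∀ w, TopologicalSpace ((Model.towerModel (pl w)).BE (Model.towerBEDatum (pl w)).E)]
    (I : LiftInput A OE (fun w => (Model.towerModel (pl w)).BE (Model.towerBEDatum (pl w)).E))
    (e : ∀ w : A.V, (Model.towerBEDatum (pl w)).Splitting)
    (hO : ∀ (w : A.V) (c : OE w), ((algebraMap (OE w) ((Model.towerModel (pl w)).BE (Model.towerBEDatum (pl w)).E) c :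
      (Model.towerModel (pl w)).BE (Model.towerBEDatum (pl w)).E) : Model.Omega (pl w)) ∈ (Model.towerBEDatum (pl w)).E)
    (hφc : ∀ w : A.V, Continuous (Model.towerBEDatum (pl w)).frobBE)
    (hφc' : ∀ w : A.V, Continuous (Model.towerBEDatum (pl w)).frobBE.symm) :
    letI : ∀ w, MulAction (Model.towerBEDatum (pl w)).GE ((Model.towerModel (pl w)).BE (Model.towerBEDatum (pl w)).E) :=
      fun w => (Model.towerBEDatum (pl w)).mulActionBE
    (ofPeriodRings A (fun w => Model.towerBEDatum (pl w)) OE I e).Thm671 (fun w => (Model.towerBEDatum (pl w)).GE) :=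
  thm671_ofPeriodRings_mulActionBE A (fun w => Model.towerBEDatum (pl w)) OE I e hO
    (fun w g => Model.continuous_towerBEDatum_galBE (pl w) g) hφc hφc'
    (fun w g x => Model.towerBEDatum_galBE_frobBE_comm (pl w) g x)

/-- **[J-III] Thm. 6.7.1 UNCONDITIONAL at the joint §5–§6 model** for the scalars `ℚ_p` ((r2) by `coe_algebraMap_padic_mem_E`) and the
DISCRETE topology on `B_E` ((r1) trivially): Galois-, `φ`- and `Aut(G_E)`-stability of the basic theta-values locus of every realised
adelic family over the model carriers, NO residual hypothesis. (The print's topology is the Fréchet one, §5.3.3 — untyped; this is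
satisfiability of (r1)–(r3), not their discharge for the printed objects.) [claim: Joshi2024ATS3, status: disputed] -/
theorem thm671_ofPeriodRings_towerModel_discrete
    (I : LiftInput A (fun w => ℚ_[pl w]) (fun w => (Model.towerModel (pl w)).BE (Model.towerBEDatum (pl w)).E))
    (e : ∀ w : A.V, (Model.towerBEDatum (pl w)).Splitting) :
    letI : ∀ w, TopologicalSpace ((Model.towerModel (pl w)).BE (Model.towerBEDatum (pl w)).E) := fun _ => ⊥
    letI : ∀ w, MulAction (Model.towerBEDatum (pl w)).GE ((Model.towerModel (pl w)).BE (Model.towerBEDatum (pl w)).E) :=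
      fun w => (Model.towerBEDatum (pl w)).mulActionBE
    (ofPeriodRings A (fun w => Model.towerBEDatum (pl w)) (fun w => ℚ_[pl w]) I e).Thm671
      (fun w => (Model.towerBEDatum (pl w)).GE) := by
  letI : ∀ w, TopologicalSpace ((Model.towerModel (pl w)).BE (Model.towerBEDatum (pl w)).E) := fun _ => ⊥
  haveI : ∀ w, DiscreteTopology ((Model.towerModel (pl w)).BE (Model.towerBEDatum (pl w)).E) := fun _ => ⟨rfl⟩
  exact thm671_ofPeriodRings_towerModel A pl (fun w => ℚ_[pl w]) I e
    (fun w c => (Model.towerBEDatum (pl w)).coe_algebraMap_padic_mem_E c)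
    (fun w => continuous_of_discreteTopology) (fun w => continuous_of_discreteTopology)

end TowerModel

/-! ### Non-vacuity of the unconditional statement: its input types are inhabited -/

section Witness

variable (q : ℕ) [hq : Fact q.Prime]

/-- An inhabitant of the non-§5 INPUTS of the realised family over slot T-10's toy collation datum `Model.collation` (one place, `ℓ⋇ = 2`)
with every place carrying E-t9's model carriers: the flat lift datum of §3 at every place, descent data the identity. LOGICAL witness,
nothing about Joshi's objects. [folklore] -/
def towerModel_liftInput :
    LiftInput Model.collation (fun _ => ℚ_[q]) (fun _ => (Model.towerModel q).BE (Model.towerBEDatum q).E) :=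
  letI := Model.towerModel_BE_nontrivial q
  { lift := fun w => ThetaLiftDatum.flat ℚ_[q] ((Model.towerModel q).BE (Model.towerBEDatum q).E) (Model.collation.Y w)
    oneFlat := fun _ => ()
    teich_oneFlat := fun _ => rfl
    absFlat_oneFlat := fun _ => rfl
    absK_zero := fun w y => ThetaLiftDatum.flat_absK_zero ℚ_[q] _ (Model.collation.Y w) y
    absK_xi_pos := fun w y => ThetaLiftDatum.flat_absK_xi_pos ℚ_[q] _ (Model.collation.Y w) y
    Vmod := Model.collation.V
    sel := id
    sel_injective := Function.injective_id
    Bmod := fun _ => (Model.towerModel q).BE (Model.towerBEDatum q).E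
    trace := fun _ => id }

/-- **WITNESS.** The unconditional Thm. 6.7.1 at the model speaks about a NONEMPTY class: over T-10's toy collation datum with every
place carrying E-t9's model tower at the prime `q`, the realised family built from `towerModel_liftInput` and the (5.2.5.4) splitting
`Model.towerModel_btildeSplitting` satisfies Thm. 6.7.1 (1)(2)(3) at every `w ∈ V^{odd,ss}` outright. [folklore] -/
theorem thm671_towerModel_witness :
    letI : TopologicalSpace ((Model.towerModel q).BE (Model.towerBEDatum q).E) := ⊥
    letI : MulAction (Model.towerBEDatum q).GE ((Model.towerModel q).BE (Model.towerBEDatum q).E) :=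
      (Model.towerBEDatum q).mulActionBE
    (ofPeriodRings Model.collation (fun _ => Model.towerBEDatum q) (fun _ => ℚ_[q]) (towerModel_liftInput q)
        (fun _ => Model.towerModel_btildeSplitting q)).Thm671 (fun _ => (Model.towerBEDatum q).GE) :=
  thm671_ofPeriodRings_towerModel_discrete Model.collation (fun _ => q) (towerModel_liftInput q)
    (fun _ => Model.towerModel_btildeSplitting q)

end Witness

end ATS3.AdelicLiftDatum

end Summit.ABC.IUTFork.Joshi

end
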